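import Mathlib.MeasureTheory.Measure.Haar.InnerProductSpace
import Summits.AtomisticToContinuum.HydrodynamicLimit.Theorems.CollisionIsometryCLTHsFreeEnergyConvexBasic
import HarnessLib

/-!
# Monotonicity, particle removal and the trivial bound for the inner-cube box free volume

Stub `tl_mono` of the thermodynamic-limit step of line `IdeatorTwoGen1Sketch` of the crux
`MacroClosure` (stmt-AtomisticToContinuum-14870). For Ruelle's inner-cube box free volume

`B(m, S, e) = vol {w : Fin m → ℝ³ | |w i l| ≤ S/2 for all i l, and e ≤ ‖w i - w j‖ for i ≠ j}`

(Lebesgue measure on `(ℝ³)^m`, values in `ℝ≥0∞`) we prove three elementary facts: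

* monotonicity: `B(m, S', e') ≤ B(m, S, e)` for `0 ≤ S' ≤ S` and `e ≤ e'` (the sets are nested);
* particle removal: `B(n', S, e) ≤ B(n, S, e)` for `n ≤ n'` and `0 ≤ S ≤ 1` (forgetting the last
  point maps the `(n+1)`-point set into `[-S/2, S/2]³ × (n-point set)`, measure-preservingly by
  `MeasureTheory.measurePreserving_piFinSuccAbove`, and the cube factor has Lebesgue measure
  `S³ ≤ 1`);
* the trivial bound `B(m, S, e) ≤ 1` for `0 ≤ S ≤ 1` (particle removal down to `m = 0`, where the
  configuration space is a point of mass `1`).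

Reference: D. Ruelle, *Statistical Mechanics: Rigorous Results* (1969), §3.4.
-/

open MeasureTheory Filter Set Topology
open scoped ENNReal

namespace Summit.AtomisticToContinuum.HydrodynamicLimit.Theorems.MacroClosureLine

open Literature.MathematicalPhysics.KineticTheory Literature.Analysis.FluidPDE
open Literature.Analysis.FunctionSpaces

namespace Barycentric

namespace TlMono

/-- The closed cube `[-S/2, S/2]³ ⊆ ℝ³` has Lebesgue measure at most `1` when `0 ≤ S ≤ 1`
(its measure is `S³`, computed in `Fin 3 → ℝ` through the volume-preserving `WithLp.ofLp`).
[folklore] -/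
theorem volume_cube_le_one {S : ℝ} (hS1 : S ≤ 1) :
    volume {v : V3 | ∀ l, |v l| ≤ S / 2} ≤ 1 := by
  have h : {v : V3 | ∀ l, |v l| ≤ S / 2} =
      WithLp.ofLp ⁻¹' Set.Icc (fun _ : Fin 3 => -(S / 2)) (fun _ => S / 2) := by
    ext v
    simp only [Set.mem_setOf_eq, Set.mem_preimage, Set.mem_Icc, Pi.le_def, abs_le]
    exact ⟨fun h => ⟨fun l => (h l).1, fun l => (h l).2⟩, fun h l => ⟨h.1 l, h.2 l⟩⟩
  rw [h, (PiLp.volume_preserving_ofLp (Fin 3)).measure_preimage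
    measurableSet_Icc.nullMeasurableSet, Real.volume_Icc_pi]
  simp only [sub_neg_eq_add, add_halves, Finset.prod_const, Finset.card_univ, Fintype.card_fin]
  exact pow_le_one₀ bot_le (ENNReal.ofReal_le_one.2 hS1)

/-- **One-step particle removal.** Forgetting the last of `n + 1` points maps the `(n+1)`-point
constraint set into `[-S/2, S/2]³ × (n-point constraint set)`; the splitting
`(Fin (n+1) → ℝ³) ≃ ℝ³ × (Fin n → ℝ³)` preserves Lebesgue measure and the cube factor has
measure `≤ 1`. [folklore] -/
theorem volume_succ_le (n : ℕ) {S : ℝ} (e : ℝ) (hS1 : S ≤ 1) :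
    volume {w : Fin (n + 1) → V3 | (∀ i l, |w i l| ≤ S / 2) ∧ ∀ i j, i ≠ j → e ≤ ‖w i - w j‖} ≤
      volume {w : Fin n → V3 | (∀ i l, |w i l| ≤ S / 2) ∧ ∀ i j, i ≠ j → e ≤ ‖w i - w j‖} := by
  set A : Set (Fin n → V3) :=
    {w | (∀ i l, |w i l| ≤ S / 2) ∧ ∀ i j, i ≠ j → e ≤ ‖w i - w j‖} with hA
  set B : Set V3 := {v | ∀ l, |v l| ≤ S / 2} with hB
  set E := MeasurableEquiv.piFinSuccAbove (fun _ : Fin (n + 1) => V3) (Fin.last n) with hE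
  have hP : MeasurePreserving E (volume : Measure (Fin (n + 1) → V3))
      ((volume : Measure V3).prod (volume : Measure (Fin n → V3))) :=
    measurePreserving_piFinSuccAbove (fun _ : Fin (n + 1) => (volume : Measure V3)) (Fin.last n)
  have hsub : {w : Fin (n + 1) → V3 | (∀ i l, |w i l| ≤ S / 2) ∧ ∀ i j, i ≠ j → e ≤ ‖w i - w j‖}
      ⊆ E ⁻¹' (B ×ˢ A) := by
    intro w hw
    refine ⟨fun l => hw.1 (Fin.last n) l, fun i l => hw.1 ((Fin.last n).succAbove i) l,
      fun i j hij => hw.2 _ _ fun h => hij (Fin.succAbove_right_injective h)⟩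
  calc volume {w : Fin (n + 1) → V3 | (∀ i l, |w i l| ≤ S / 2) ∧ ∀ i j, i ≠ j → e ≤ ‖w i - w j‖}
      ≤ volume (E ⁻¹' (B ×ˢ A)) := measure_mono hsub
    _ = ((volume : Measure V3).prod (volume : Measure (Fin n → V3))) (B ×ˢ A) :=
        hP.measure_preimage_equiv _
    _ = volume B * volume A := Measure.prod_prod _ _
    _ ≤ 1 * volume A := mul_le_mul_left (volume_cube_le_one hS1) _
    _ = volume A := one_mul _

/-- **Particle removal.** For `n ≤ n'` and `S ≤ 1` the `n'`-point box free volume is at most the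
`n`-point one (iterate `volume_succ_le`). [folklore] -/
theorem volume_le_of_le {n n' : ℕ} {S : ℝ} (e : ℝ) (hnn' : n ≤ n') (hS1 : S ≤ 1) :
    volume {w : Fin n' → V3 | (∀ i l, |w i l| ≤ S / 2) ∧ ∀ i j, i ≠ j → e ≤ ‖w i - w j‖} ≤
      volume {w : Fin n → V3 | (∀ i l, |w i l| ≤ S / 2) ∧ ∀ i j, i ≠ j → e ≤ ‖w i - w j‖} := by
  obtain ⟨d, rfl⟩ := Nat.exists_eq_add_of_le hnn'
  clear hnn'
  induction d with
  | zero => exact le_rfl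
  | succ d ih => exact (volume_succ_le (n + d) e hS1).trans ih

/-- The configuration space of zero points `Fin 0 → ℝ³` has total Lebesgue measure `1`
(empty product). [folklore] -/
theorem volume_univ_fin_zero : volume (Set.univ : Set (Fin 0 → V3)) = 1 := by
  rw [show (volume : Measure (Fin 0 → V3)) = Measure.pi fun _ => volume from rfl, Measure.pi_univ]
  simp

end TlMono

open TlMono in
/-- **TL-mono: monotonicity, particle removal and the trivial bound for Ruelle's inner-cube box
free volume** `B(m, S, e) = vol {w : Fin m → ℝ³ | |w i l| ≤ S/2, pairwise e ≤ ‖w i - w j‖}`: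
(i) `B(m, S', e') ≤ B(m, S, e)` for `0 ≤ S' ≤ S`, `e ≤ e'` (nested sets);
(ii) `B(n', S, e) ≤ B(n, S, e)` for `n ≤ n'`, `0 ≤ S ≤ 1` (forget the extra points; each removed
cube factor has Lebesgue measure `S³ ≤ 1`);
(iii) `B(m, S, e) ≤ 1` for `0 ≤ S ≤ 1` (remove all points). [folklore] -/
theorem tl_mono : (∀ (m : ℕ) (S S' e e' : ℝ), 0 ≤ S' → S' ≤ S → e ≤ e' → volume {w : Fin m → V3 | (∀ i l, |w i l| ≤ S' / 2) ∧ ∀ i j, i ≠ j → e' ≤ ‖w i - w j‖} ≤ volume {w : Fin m → V3 | (∀ i l, |w i l| ≤ S / 2) ∧ ∀ i j, i ≠ j → e ≤ ‖w i - w j‖}) ∧ (∀ (n n' : ℕ) (S e : ℝ), n ≤ n' → 0 ≤ S → S ≤ 1 → volume {w : Fin n' → V3 | (∀ i l, |w i l| ≤ S / 2) ∧ ∀ i j, i ≠ j → e ≤ ‖w i - w j‖} ≤ volume {w : Fin n → V3 | (∀ i l, |w i l| ≤ S / 2) ∧ ∀ i j, i ≠ j → e ≤ ‖w i - w j‖})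 ∧ (∀ (m : ℕ) (S e : ℝ), 0 ≤ S → S ≤ 1 → volume {w : Fin m → V3 | (∀ i l, |w i l| ≤ S / 2) ∧ ∀ i j, i ≠ j → e ≤ ‖w i - w j‖} ≤ 1) := by
  refine ⟨fun m S S' e e' _ hS'S hee' => ?_, fun n n' S e hnn' _ hS1 => volume_le_of_le e hnn' hS1,
    fun m S e _ hS1 => ?_⟩
  · refine measure_mono fun w hw => ⟨fun i l => (hw.1 i l).trans (by linarith), fun i j hij => ?_⟩
    exact hee'.trans (hw.2 i j hij)
  · calc volume {w : Fin m → V3 | (∀ i l, |w i l| ≤ S / 2) ∧ ∀ i j, i ≠ j → e ≤ ‖w i - w j‖}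
        ≤ volume {w : Fin 0 → V3 | (∀ i l, |w i l| ≤ S / 2) ∧ ∀ i j, i ≠ j → e ≤ ‖w i - w j‖} :=
          volume_le_of_le e (Nat.zero_le m) hS1
      _ ≤ volume (Set.univ : Set (Fin 0 → V3)) := measure_mono (Set.subset_univ _)
      _ = 1 := volume_univ_fin_zero

end Barycentric

end Summit.AtomisticToContinuum.HydrodynamicLimit.Theorems.MacroClosureLine
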